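import Summits.CriticalPhenomena.SAWScalingLimit.Theorems.SAWCompassLatticeSurfaceUniversalitySiteDictionary
import Literature.Probability.Percolation.HalfAnnulusQuad

/-!
# `LipApproxIndependence` is false, I: the arch, the designer rule, corridor forcing

Permanent negative knowledge for the crux `SAWCompassLattice.SurfaceUniversality`
(stmt-CriticalPhenomena-6964), line `registered`: the ALL-RULES approximation-independence statement
`LipApproxIndependence` of skeleton v6 (`…SurfaceUniversalityApproxDefs`) is refuted in
`…/SurfaceUniversality/Negative/LipApproxIndependenceFalse.lean` (parts II, III continue this file).
This part supplies the static half of the witness: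

* `oct` — the arch octagon `U = {0 < im < 2, -2 < re < 2, (1 < re ∨ re < -1 ∨ 1 < im)}` (the
  half-annulus octagon of `Literature/Probability/Percolation/HalfAnnulusQuad.lean` with `L = 2`),
  marked at the convex corner `a = pt 0 = 1` and at `b = pt 1 = 2` (`oct_pt_zero`, `oct_pt_one`);
  `mem_closure_oct_iff` (its closure `closedArch` in closed linear conditions);
* `rule` — the designer probe rule `ρ₀`: centre probe `{0}`, vertical-port probe `{-3/2}`,
  horizontal-port probe `{-2i}`, closed flags (kind-asymmetric singleton probes in `closedBall 0 2`);
  `centre_mem_iff`, `vert_mem_iff`, `slant_mem_iff` — a vertex is kept iff an explicit shifted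
  point lies in `closedArch`; `draw_centre`, `draw_vert_im` — drawn coordinates;
* `adj_centre`, `adj_vert`, `adj_slant` — neighbourhoods in the plus lattice;
* `forced_chain`, `forced_chain_unique` — a self-avoiding path from the sealed end of a corridor
  `a 0, b 0, a 1, b 1, …` (`a 0` has the single kept neighbour `b 0`, `b i` only the neighbours
  `a i, a (i+1)`, `a (i+1)` only the kept neighbours `b i, b (i+1)`) follows the corridor; with
  target `a N` it is unique.

No SAW estimate anywhere; everything is [folklore] bookkeeping (the witness is worker W4's of lead c2,
`Cruxes/SurfaceUniversality/Lines/birth-lipApproxIndependence-refutation.md`, made uniform in `δ`).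
-/

noncomputable section

namespace Summit.CriticalPhenomena.SAWScalingLimit.Theorems.SurfaceUniversality.Negative

open Set Metric
open Literature.Probability.RandomPlanarGeometry
open Literature.Probability.RandomPlanarGeometry.SAW
open Literature.Probability.RandomPlanarGeometry.SAW.YangBaxter
open Literature.Probability.Percolation.HalfPlaneArm
open Summit.CriticalPhenomena.SAWScalingLimit.Cruxes.HexTransfer.Sketch.Surface
  (planeCorner_rightAngles colShift_rightAngles)
open Complex (I)

/-! ### The arch octagon marked at `1` and `2` -/

/-- `1 < 2` in `ℝ` (the size parameter of the octagon). [folklore] -/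
theorem one_lt_two' : (1 : ℝ) < 2 := by norm_num

/-- **The witness domain**: the inside of the simple closed octagon
`-1, -1+i, 1+i, 1, 2, 2+2i, -2+2i, -2` (the arch `{0<im<2, -2<re<2} ∖ [-1,1]×[0,1]`), marked at the
corners `1` (parameter `3/8`) and `2` (parameter `1/2`). [folklore] -/
def oct : DobrushinDomain where
  toJordanDomain := polygonDomain _ (isSimpleClosedPolygon_verts one_lt_two')
  mark := ![3 / 8, 1 / 2]
  strictMono_mark := Fin.strictMono_iff_lt_succ.2 fun i => by fin_cases i; simp; norm_num
  mark_mem i := by fin_cases i <;> simp <;> norm_num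

/-- The closed arch `{0 ≤ im ≤ 2, -2 ≤ re ≤ 2, (1 ≤ re ∨ re ≤ -1 ∨ 1 ≤ im)}`. [folklore] -/
def closedArch : Set ℂ :=
  {z | 0 ≤ z.im ∧ z.im ≤ 2 ∧ -2 ≤ z.re ∧ z.re ≤ 2 ∧ (1 ≤ z.re ∨ z.re ≤ -1 ∨ 1 ≤ z.im)}

/-- Membership of a point given in coordinates in the closed arch. [folklore] -/
theorem mk_mem_closedArch_iff {x y : ℝ} : (⟨x, y⟩ : ℂ) ∈ closedArch ↔
    0 ≤ y ∧ y ≤ 2 ∧ -2 ≤ x ∧ x ≤ 2 ∧ (1 ≤ x ∨ x ≤ -1 ∨ 1 ≤ y) := Iff.rfl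

/-- The carrier of `oct` is the open arch. [folklore] -/
theorem oct_carrier : oct.carrier =
    {z : ℂ | 0 < z.im ∧ z.im < 2 ∧ -2 < z.re ∧ z.re < 2 ∧ (1 < z.re ∨ z.re < -1 ∨ 1 < z.im)} :=
  polygonDomain_verts_carrier one_lt_two'

/-- **The closure of the arch** is the closed arch `{0≤im≤2, -2≤re≤2, (1≤re ∨ re≤-1 ∨ 1≤im)}`.
[folklore] -/
theorem mem_closure_oct_iff {z : ℂ} : z ∈ closure oct.carrier ↔ z ∈ closedArch := by
  rw [closure_eq_self_union_frontier, show frontier oct.carrier = _ from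
    frontier_polygonDomain_eq_range _ (isSimpleClosedPolygon_verts one_lt_two'), oct_carrier,
    mem_union, mem_setOf_eq, mem_range_polygonLoop_verts_iff one_lt_two', closedArch, mem_setOf_eq]
  constructor
  · rintro (⟨h0, h1, h2, h3, h4⟩ | hz)
    · exact ⟨h0.le, h1.le, h2.le, h3.le, h4.imp le_of_lt (Or.imp le_of_lt le_of_lt)⟩
    · rcases hz with ⟨a, b, c⟩ | ⟨a, b, c⟩ | ⟨a, b, c⟩ | ⟨a, b, c⟩ | ⟨a, b, c⟩ | ⟨a, b, c⟩ |
        ⟨a, b, c⟩ | ⟨a, b, c⟩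
      · exact ⟨b, by linarith, by linarith, by linarith, Or.inr (Or.inl a.le)⟩
      · exact ⟨by linarith, by linarith, by linarith, by linarith, Or.inr (Or.inr a.ge)⟩
      · exact ⟨b, by linarith, by linarith, by linarith, Or.inl a.ge⟩
      · exact ⟨a.ge, by linarith, by linarith, c, Or.inl b⟩
      · exact ⟨b, c, by linarith, a.le, Or.inl (by linarith)⟩
      · exact ⟨by linarith, a.le, b, c, Or.inr (Or.inr (by linarith))⟩
      · exact ⟨b, c, a.ge, by linarith, Or.inr (Or.inl (by linarith))⟩
      · exact ⟨a.ge, by linarith, b, by linarith, Or.inr (Or.inl c)⟩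
  · rintro ⟨h0, h1, h2, h3, h4⟩
    by_cases h : 0 < z.im ∧ z.im < 2 ∧ -2 < z.re ∧ z.re < 2 ∧ (1 < z.re ∨ z.re < -1 ∨ 1 < z.im)
    · exact Or.inl h
    · refine Or.inr ?_
      simp only [not_and_or, not_or, not_lt] at h
      rcases h with h | h | h | h | ⟨h5, h6, h7⟩
      · have him : z.im = 0 := le_antisymm h h0
        rcases h4 with h4 | h4 | h4
        · exact Or.inr (Or.inr (Or.inr (Or.inl ⟨him, h4, h3⟩)))
        · exact Or.inr (Or.inr (Or.inr (Or.inr (Or.inr (Or.inr (Or.inr ⟨him, h2, h4⟩))))))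
        · exfalso; linarith
      · exact Or.inr (Or.inr (Or.inr (Or.inr (Or.inr (Or.inl ⟨le_antisymm h1 h, h2, h3⟩)))))
      · exact Or.inr (Or.inr (Or.inr (Or.inr (Or.inr (Or.inr (Or.inl ⟨le_antisymm h h2, h0, h1⟩))))))
      · exact Or.inr (Or.inr (Or.inr (Or.inr (Or.inl ⟨le_antisymm h3 h, h0, h1⟩))))
      · rcases h4 with h4 | h4 | h4
        · exact Or.inr (Or.inr (Or.inl ⟨le_antisymm h5 h4, h0, h7⟩))
        · exact Or.inl ⟨le_antisymm h4 h6, h0, h7⟩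
        · exact Or.inr (Or.inl ⟨le_antisymm h7 h4, h6, h5⟩)

/-- The first marked point of `oct` is the convex corner `1`. [folklore] -/
theorem oct_pt_zero : oct.pt 0 = 1 := by
  have h := polygonLoop_vertex (l := [(⟨-1, 0⟩ : ℂ), ⟨-1, 1⟩, ⟨1, 1⟩, ⟨1, 0⟩, ⟨(2 : ℝ), 0⟩,
    ⟨(2 : ℝ), (2 : ℝ)⟩, ⟨-(2 : ℝ), (2 : ℝ)⟩, ⟨-(2 : ℝ), 0⟩]) (k := 3) (by simp)
  have h38 : ((3 : ℕ) : ℝ) / ((8 : ℕ) : ℝ) = 3 / 8 := by norm_num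
  simp only [List.length_cons, List.length_nil, Nat.reduceAdd, h38] at h
  change polygonLoop _ ((![3 / 8, 1 / 2] : Fin 2 → ℝ) 0) = 1
  simp only [Matrix.cons_val_zero]
  rw [h]
  apply Complex.ext <;> simp

/-- The second marked point of `oct` is the corner `2`. [folklore] -/
theorem oct_pt_one : oct.pt 1 = 2 := by
  have h := polygonLoop_vertex (l := [(⟨-1, 0⟩ : ℂ), ⟨-1, 1⟩, ⟨1, 1⟩, ⟨1, 0⟩, ⟨(2 : ℝ), 0⟩,
    ⟨(2 : ℝ), (2 : ℝ)⟩, ⟨-(2 : ℝ), (2 : ℝ)⟩, ⟨-(2 : ℝ), 0⟩]) (k := 4) (by simp)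
  have h48 : ((4 : ℕ) : ℝ) / ((8 : ℕ) : ℝ) = 1 / 2 := by norm_num
  simp only [List.length_cons, List.length_nil, Nat.reduceAdd, h48] at h
  change polygonLoop _ ((![3 / 8, 1 / 2] : Fin 2 → ℝ) 1) = 2
  simp only [Matrix.cons_val_one, Matrix.cons_val_zero]
  rw [h]
  apply Complex.ext <;> simp

/-! ### The designer probe rule -/

/-- **The designer rule** `ρ₀`: a centre is kept iff its own point lies in `closure Ω`; a vertical
port iff the point `3δ/2` to its WEST does; a horizontal port iff the point `2δ` to its SOUTH does
(kind-asymmetric singleton probes, all in `closedBall 0 2`). [folklore] -/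
def rule : ProbeRule where
  centre := [({0}, true)]
  vport := [({-(3 / 2 : ℂ)}, true)]
  hport := [({-2 * I}, true)]
  centre_ne_nil := List.cons_ne_nil _ _
  vport_ne_nil := List.cons_ne_nil _ _
  hport_ne_nil := List.cons_ne_nil _ _
  centre_ok := probes_ok_singleton (singleton_nonempty _) (by simp) _
  vport_ok := probes_ok_singleton (singleton_nonempty _)
    (by rw [singleton_subset_iff, mem_closedBall, dist_zero_right, norm_neg]; norm_num) _
  hport_ok := probes_ok_singleton (singleton_nonempty _)
    (by rw [singleton_subset_iff, mem_closedBall, dist_zero_right, norm_mul, norm_neg,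
      Complex.norm_I]; norm_num) _

/-- The probe vector of the designer rule at a vertex (by kind). [folklore] -/
def probeVec : PVert → ℂ
  | .inr _ => 0
  | .inl (.vert _ _) => -(3 / 2 : ℂ)
  | .inl (.slant _ _) => -2 * I

/-- A vertex is kept by the designer rule iff its probe point lies in `closure Ω`. [folklore] -/
theorem mem_support_rule_iff {Ω : Set ℂ} {δ : ℝ} {v : PVert} :
    v ∈ probeSupport rule Ω δ ↔ (δ : ℂ) * (PortGadget.embed plusPos v + probeVec v) ∈ closure Ω := by
  rcases v with (⟨k, j⟩ | ⟨k, j⟩) | ⟨f, u⟩ <;>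
    simp [mem_probeSupport_iff, ProbeRule.probesAt, rule, probeTarget, probeVec]

/-- A complex number is determined by its coordinates. [folklore] -/
theorem eq_mk_of_re_im {z : ℂ} {x y : ℝ} (hx : z.re = x) (hy : z.im = y) : z = ⟨x, y⟩ :=
  Complex.ext hx hy

/-- The probe point of a centre: `δ(k + 1/2) + δ j i`. [folklore] -/
theorem probePt_centre (δ : ℝ) (k j : ℤ) :
    (δ : ℂ) * (PortGadget.embed plusPos (Sum.inr ((k, j), ()) : PVert) +
      probeVec (Sum.inr ((k, j), ()))) = ⟨δ * (k + 1 / 2), δ * j⟩ := by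
  refine eq_mk_of_re_im ?_ ?_
  · rw [Complex.re_ofReal_mul]; congr 1
    simp [PortGadget.embed, plusPos, planeCorner_rightAngles, probeVec]
  · rw [Complex.im_ofReal_mul]; congr 1
    simp [PortGadget.embed, plusPos, planeCorner_rightAngles, probeVec]

/-- The probe point of a vertical port: `δ(k - 3/2) + δ j i`. [folklore] -/
theorem probePt_vert (δ : ℝ) (k j : ℤ) :
    (δ : ℂ) * (PortGadget.embed plusPos (Sum.inl (.vert k j) : PVert) +
      probeVec (Sum.inl (.vert k j))) = ⟨δ * (k - 3 / 2), δ * j⟩ := by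
  refine eq_mk_of_re_im ?_ ?_
  · rw [Complex.re_ofReal_mul]; congr 1
    simp [PortGadget.embed, planeMidpoint, planeCorner_rightAngles, probeVec]; ring
  · rw [Complex.im_ofReal_mul]; congr 1
    simp [PortGadget.embed, planeMidpoint, planeCorner_rightAngles, probeVec]

/-- The probe point of a horizontal port: `δ(k + 1/2) + δ(j - 5/2) i`. [folklore] -/
theorem probePt_slant (δ : ℝ) (k j : ℤ) :
    (δ : ℂ) * (PortGadget.embed plusPos (Sum.inl (.slant k j) : PVert) +
      probeVec (Sum.inl (.slant k j))) = ⟨δ * (k + 1 / 2), δ * (j - 5 / 2)⟩ := by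
  refine eq_mk_of_re_im ?_ ?_
  · rw [Complex.re_ofReal_mul]; congr 1
    simp [PortGadget.embed, planeMidpoint, planeCorner_rightAngles, colShift_rightAngles, probeVec]
  · rw [Complex.im_ofReal_mul]; congr 1
    simp [PortGadget.embed, planeMidpoint, planeCorner_rightAngles, colShift_rightAngles, probeVec]
    ring

/-- A centre `(k, j)` is kept in the arch iff `δ(k+1/2) + δ j i` lies in the closed arch. [folklore] -/
theorem centre_mem_iff {δ : ℝ} {k j : ℤ} :
    (Sum.inr ((k, j), ()) : PVert) ∈ probeSupport rule oct.carrier δ ↔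
      (⟨δ * (k + 1 / 2), δ * j⟩ : ℂ) ∈ closedArch := by
  rw [mem_support_rule_iff, mem_closure_oct_iff, probePt_centre]

/-- A vertical port `vert k j` is kept in the arch iff `δ(k-3/2) + δ j i` lies in the closed arch.
[folklore] -/
theorem vert_mem_iff {δ : ℝ} {k j : ℤ} :
    (Sum.inl (.vert k j) : PVert) ∈ probeSupport rule oct.carrier δ ↔
      (⟨δ * (k - 3 / 2), δ * j⟩ : ℂ) ∈ closedArch := by
  rw [mem_support_rule_iff, mem_closure_oct_iff, probePt_vert]

/-- A horizontal port `slant k j` is kept in the arch iff `δ(k+1/2) + δ(j-5/2) i` lies in the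
closed arch. [folklore] -/
theorem slant_mem_iff {δ : ℝ} {k j : ℤ} :
    (Sum.inl (.slant k j) : PVert) ∈ probeSupport rule oct.carrier δ ↔
      (⟨δ * (k + 1 / 2), δ * (j - 5 / 2)⟩ : ℂ) ∈ closedArch := by
  rw [mem_support_rule_iff, mem_closure_oct_iff, probePt_slant]

/-- The drawn point of a centre: `δ(k + 1/2) + δ j i`. [folklore] -/
theorem draw_centre (δ : ℝ) (k j : ℤ) :
    (δ : ℂ) * PortGadget.embed plusPos (Sum.inr ((k, j), ()) : PVert) = ⟨δ * (k + 1 / 2), δ * j⟩ := by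
  simpa [probeVec] using probePt_centre δ k j

/-- The drawn point of a vertical port has ordinate `δ j`. [folklore] -/
theorem draw_vert_im (δ : ℝ) (k j : ℤ) :
    ((δ : ℂ) * PortGadget.embed plusPos (Sum.inl (.vert k j) : PVert)).im = δ * j := by
  rw [Complex.im_ofReal_mul]; congr 1
  simp [PortGadget.embed, planeMidpoint, planeCorner_rightAngles]

/-! ### Neighbourhoods in the plus lattice -/

/-- The neighbours of a centre are its four ports. [folklore] -/
theorem adj_centre {k j : ℤ} {w : PVert} (h : plusLattice.Adj (Sum.inr ((k, j), ())) w) :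
    w = Sum.inl (.vert k j) ∨ w = Sum.inl (.vert (k + 1) j) ∨ w = Sum.inl (.slant k j) ∨
      w = Sum.inl (.slant k (j + 1)) := by
  rcases w with e | ⟨f, u⟩
  · rw [plusLattice_adj_inr_inl] at h
    obtain ⟨s, rfl⟩ := h
    cases s <;> simp [Face.side]
  · simp at h

/-- The neighbours of a vertical port are the centres west and east of it. [folklore] -/
theorem adj_vert {k j : ℤ} {w : PVert} (h : plusLattice.Adj (Sum.inl (.vert k j)) w) :
    w = Sum.inr ((k - 1, j), ()) ∨ w = Sum.inr ((k, j), ()) := by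
  rcases w with e | ⟨⟨a, b⟩, u⟩
  · simp at h
  · rw [plusLattice_adj_inl_inr] at h
    obtain ⟨s, hs⟩ := h
    cases s <;> simp only [Face.side, MidEdge.vert.injEq, reduceCtorEq] at hs
    · obtain ⟨rfl, rfl⟩ := hs; exact Or.inr rfl
    · obtain ⟨rfl, rfl⟩ := hs; exact Or.inl (by simp)

/-- The neighbours of a horizontal port are the centres south and north of it. [folklore] -/
theorem adj_slant {k j : ℤ} {w : PVert} (h : plusLattice.Adj (Sum.inl (.slant k j)) w) :
    w = Sum.inr ((k, j - 1), ()) ∨ w = Sum.inr ((k, j), ()) := by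
  rcases w with e | ⟨⟨a, b⟩, u⟩
  · simp at h
  · rw [plusLattice_adj_inl_inr] at h
    obtain ⟨s, hs⟩ := h
    cases s <;> simp only [Face.side, MidEdge.slant.injEq, reduceCtorEq] at hs
    · obtain ⟨rfl, rfl⟩ := hs; exact Or.inr rfl
    · obtain ⟨rfl, rfl⟩ := hs; exact Or.inl (by simp)

/-- Centre — east port. [folklore] -/
theorem adj_centre_east (k j : ℤ) :
    plusLattice.Adj (Sum.inr ((k, j), ()) : PVert) (Sum.inl (.vert (k + 1) j)) :=
  (plusLattice_adj_inr_inl _ _ _).2 ⟨.E, rfl⟩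

/-- West port — centre. [folklore] -/
theorem adj_west_centre (k j : ℤ) :
    plusLattice.Adj (Sum.inl (.vert k j) : PVert) (Sum.inr ((k, j), ())) :=
  (plusLattice_adj_inl_inr _ _ _).2 ⟨.W, rfl⟩

/-- Centre — north port. [folklore] -/
theorem adj_centre_north (k j : ℤ) :
    plusLattice.Adj (Sum.inr ((k, j), ()) : PVert) (Sum.inl (.slant k (j + 1))) :=
  (plusLattice_adj_inr_inl _ _ _).2 ⟨.N, rfl⟩

/-- South port — centre. [folklore] -/
theorem adj_south_centre (k j : ℤ) :
    plusLattice.Adj (Sum.inl (.slant k j) : PVert) (Sum.inr ((k, j), ())) :=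
  (plusLattice_adj_inl_inr _ _ _).2 ⟨.S, rfl⟩

/-! ### Forced corridors -/

/-- **Corridor forcing.** In a graph `G`, let `a 0, b 0, a 1, b 1, …` be a chain such that the only
neighbour of `a 0` in `S` is `b 0`, the only neighbours of `b i` (`i < N`) are `a i, a (i+1)`, and the
only neighbours in `S` of `a (i+1)` (`i + 1 < N`) are `b i, b (i+1)`. Then every self-avoiding path
from `a 0` through `S` to a vertex `v` off the chain before `a N` follows the chain: it has length
`≥ 2N` and its `2i`-th / `(2i+1)`-st vertices are `a i` / `b i`. [folklore] -/
theorem forced_chain {V : Type*} {G : SimpleGraph V} {S : Set V} (a b : ℕ → V) (N : ℕ)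
    (h0 : ∀ w ∈ S, G.Adj (a 0) w → w = b 0)
    (hb : ∀ i, i < N → ∀ w, G.Adj (b i) w → w = a i ∨ w = a (i + 1))
    (ha : ∀ i, i + 1 < N → ∀ w ∈ S, G.Adj (a (i + 1)) w → w = b i ∨ w = b (i + 1))
    {v : V} (hva : ∀ i, i < N → a i ≠ v) (hvb : ∀ i, i < N → b i ≠ v)
    {p : G.Walk (a 0) v} (hp : p.IsPath) (hS : ∀ w ∈ p.support, w ∈ S) :
    ∀ i, i ≤ N → 2 * i ≤ p.length ∧ p.getVert (2 * i) = a i ∧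
      (i < N → 2 * i + 1 ≤ p.length ∧ p.getVert (2 * i + 1) = b i) := by
  have hinj := hp.getVert_injOn
  have hlen : ∀ k, p.getVert k ≠ v → k ≠ p.length := fun k hk h => hk (h ▸ p.getVert_length)
  intro i
  induction i with
  | zero =>
    intro _
    have hg0 : p.getVert 0 = a 0 := p.getVert_zero
    refine ⟨Nat.zero_le _, hg0, fun hN => ?_⟩
    have h1 : 2 * 0 + 1 ≤ p.length := by
      have := hlen 0 (by rw [hg0]; exact hva 0 hN); omega
    refine ⟨h1, ?_⟩
    have hadj := p.adj_getVert_succ (i := 0) (by omega)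
    rw [hg0] at hadj
    exact h0 _ (hS _ (p.getVert_mem_support _)) hadj
  | succ i ih =>
    intro hi
    have hiN : i < N := by omega
    obtain ⟨-, hga, hrest⟩ := ih hiN.le
    obtain ⟨hl1, hgb⟩ := hrest hiN
    have hl2 : 2 * (i + 1) ≤ p.length := by
      have := hlen _ (by rw [hgb]; exact hvb i hiN); omega
    have hga' : p.getVert (2 * (i + 1)) = a (i + 1) := by
      have hadj := p.adj_getVert_succ (i := 2 * i + 1) (by omega)
      rw [hgb, show 2 * i + 1 + 1 = 2 * (i + 1) by ring] at hadj
      rcases hb i hiN _ hadj with h | h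
      · have := hinj (show 2 * (i + 1) ∈ {i | i ≤ p.length} from hl2)
          (show 2 * i ∈ {i | i ≤ p.length} by simp only [Set.mem_setOf_eq]; omega) (h.trans hga.symm)
        omega
      · exact h
    refine ⟨hl2, hga', fun hi' => ?_⟩
    have hl3 : 2 * (i + 1) + 1 ≤ p.length := by
      have := hlen _ (by rw [hga']; exact hva (i + 1) hi'); omega
    refine ⟨hl3, ?_⟩
    have hadj := p.adj_getVert_succ (i := 2 * (i + 1)) (by omega)
    rw [hga'] at hadj
    rcases ha i hi' _ (hS _ (p.getVert_mem_support _)) hadj with h | h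
    · have := hinj (show 2 * (i + 1) + 1 ∈ {i | i ≤ p.length} from hl3)
        (show 2 * i + 1 ∈ {i | i ≤ p.length} by simp only [Set.mem_setOf_eq]; omega) (h.trans hgb.symm)
      omega
    · exact h

/-- **Corridor uniqueness.** Under the hypotheses of `forced_chain` with target `v = a N`, a
self-avoiding path from `a 0` to `a N` through `S` has length `2N` and prescribed vertices; hence
any two such paths coincide. [folklore] -/
theorem forced_chain_unique {V : Type*} {G : SimpleGraph V} {S : Set V} (a b : ℕ → V) (N : ℕ)
    (h0 : ∀ w ∈ S, G.Adj (a 0) w → w = b 0)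
    (hb : ∀ i, i < N → ∀ w, G.Adj (b i) w → w = a i ∨ w = a (i + 1))
    (ha : ∀ i, i + 1 < N → ∀ w ∈ S, G.Adj (a (i + 1)) w → w = b i ∨ w = b (i + 1))
    (hva : ∀ i, i < N → a i ≠ a N) (hvb : ∀ i, i < N → b i ≠ a N)
    {p q : G.Walk (a 0) (a N)} (hp : p.IsPath) (hpS : ∀ w ∈ p.support, w ∈ S)
    (hq : q.IsPath) (hqS : ∀ w ∈ q.support, w ∈ S) : p = q := by
  have HP := forced_chain a b N h0 hb ha hva hvb hp hpS
  have HQ := forced_chain a b N h0 hb ha hva hvb hq hqS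
  have hlenp : p.length = 2 * N := by
    obtain ⟨hl, hg, -⟩ := HP N le_rfl
    exact (hp.getVert_injOn (show p.length ∈ {i | i ≤ p.length} by simp) hl
      (p.getVert_length.trans hg.symm))
  have hlenq : q.length = 2 * N := by
    obtain ⟨hl, hg, -⟩ := HQ N le_rfl
    exact (hq.getVert_injOn (show q.length ∈ {i | i ≤ q.length} by simp) hl
      (q.getVert_length.trans hg.symm))
  refine SimpleGraph.Walk.ext_getVert_le_length (hlenp.trans hlenq.symm) fun k hk => ?_
  rw [hlenp] at hk
  obtain ⟨i, rfl | rfl⟩ := Nat.even_or_odd' k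
  · rw [(HP i (by omega)).2.1, (HQ i (by omega)).2.1]
  · rw [((HP i (by omega)).2.2 (by omega)).2, ((HQ i (by omega)).2.2 (by omega)).2]

end Summit.CriticalPhenomena.SAWScalingLimit.Theorems.SurfaceUniversality.Negative

end
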